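import Literature.MathematicalPhysics.QuantumFieldTheory.King1986.SlicePropagatorStatementsAt
import Literature.MathematicalPhysics.QuantumFieldTheory.Balaban1983to89.B3Ineq211RegularBoxCarrier
import Summits.QuantumFields.YangMills.Theorems.BalabanUVNodesN15KingModelProp37AtRegularFieldHolder
import Summits.QuantumFields.YangMills.Theorems.BalabanUVNodesN15KingModelThm33AtRegularFieldIntervalBox

/-!
# N15 (NE2⁺, row s3 KING-MODEL ∕ RIEMANN-KERNEL RUNG) — PART Ζ-e₁: THE TRANSPORT-FREE HÖLDER LINES (3.65) FOR `G^η_{(j)}(Ω′, A^{(k)})` — A REGULAR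
# BACKGROUND ON A BIG-BLOCK INTERVAL BOX `Ω′ ⊂ T_ε` (p. 665 «Proposition 3.7 also holds for G_(j)(Ω′) and G_(j)(Ω′, A^{(k)})»); the sequel Ζ-e₂ inhabits the schema

count-neutral helper of the pub-ymgap K3⁸ programme (`--supports stmt-QuantumFields-27366`); nothing here is a claim about Bałaban's
non-abelian `G(U)`, the continuum, ℝ⁴, OS axioms, a mass gap or the Clay problem.  One finite torus `T_ε` at fixed `ε`.

## What is printed

[King1986] = C. King, CMP **102** (1986) 649–677, Prop. 3.7 (3.62)–(3.65) p. 663 (quoted in PART Ζ-a) and p. 665 [PDF 17] l. 22–23: *"We note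
that Proposition 3.7 also holds for G^η_{(j)}(Ω′) and G^η_{(j)}(Ω′, A^{(k)}), since Theorem 3.3 gives bounds on these operators also."* — `Ω′` a cube
which is a union of large blocks (p. 661), `A^{(k)}` regular on it.  [Balaban1983Higgs3] (2.10)–(2.11) p. 426 on a box: [Balaban1982Higgs1] p. 611 l. 1–2
*"For some simple sets Ω, e.g. for rectangular parallelepipeds, the inequalities hold without any restrictions on the points x, x′"* — PROVED in the
tree by lit-balaban p26 for the pieces `G^η_{(j)}(Ω, A)` of (I.2.43) of the REGION operators on every cell-product box, regularity of `A` required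
on the box only: `B3Ineq211RegularBoxCarrier.ineq210_and_211At_regularBoxH_small` (carrier `regBoxKernelsH`).

## What this file proves

* §1 the block-norm kernels of p26's box carrier: non-negativity, the readers at bonds inside the box, the one-bond step
  `||G_(j)(x+εe_μ,z)| − |G_(j)(x,z)|| ≤ ε|(D_{A,μ}G_(j))(x,z)|` for bonds INSIDE the box (isometry, PART Ζ-a's letter), chain telescoping along
  nearest-neighbour chains INSIDE the box (`pathEnd_mem`).
* §2 ★ `absG_holder_near_box` ∕ `absG_holder_far_box` ∕ ★★ `absG_holder_le_box` — (3.65)₁ transport-free on an INTERVAL box with sides at most half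
  the torus, for all bond-closed pairs `x ≠ y` (the chains are the rung's coordinate staircases `legsK`, which stay in the box:
  g21 `legsK_subset_intervalBox`); ★★ `absDG_holder_le_box` — (3.65)₂ transport-free from (2.11) on the box (`holderTermR_le_holderDiffB` + isometry).
(The sequel PART Ζ-e₂ `…Prop37AtRegularFieldBox` builds King's datum on the bond-closed sites and inhabits `Prop37PrintedAt` ∕ `Prop37KingOrder`.)

HONEST SCOPE.  Block-norm reading (PART Ζ-a); interval boxes of r14∕p26's cell family with sides ≤ half the torus (so the coordinate staircases stay
inside); sites restricted to the bond-closed layer `bset Ω′` (one fine site short of `Ω′` in each forward direction); (3.64) empty by type here (the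
vector clause is PART Ζ-d's, on the torus); constants per `(α, K₀)`; `m² > 0`.  NOT an η-rate; NE2⁺ for Bałaban's `G(U)` NOT proved; N15 NOT discharged.
Unit `pub-ymgap-dag-n15-e` g22 (R141 (C) s3), PART Ζ-e₁.
-/

noncomputable section

open scoped BigOperators

namespace Summit.QuantumFields.YangMills.BalabanUVNodes.N15KingModelRung.RegularField

open Literature.MathematicalPhysics.QuantumFieldTheory.Balaban1983to89
open Literature.MathematicalPhysics.QuantumFieldTheory.Balaban1983to89.HiggsLattice (ChargeData ScalarField covDeriv)
open Literature.MathematicalPhysics.QuantumFieldTheory.Balaban1983to89.B1Eq230FluctCov (Ix cb)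
open Literature.MathematicalPhysics.QuantumFieldTheory.Balaban1983to89.B1Ineq234LevelZero (tdist_comm tdist_triangle_real)
open Literature.MathematicalPhysics.QuantumFieldTheory.Balaban1983to89.B1TorusChainTransport (IsTChain TNbr hol norm_hol_apply tdist_mem_chain_le)
open Literature.MathematicalPhysics.QuantumFieldTheory.Balaban1983to89.B2Restr216Lattice (norm_U_apply)
open Literature.MathematicalPhysics.QuantumFieldTheory.Balaban1983to89.B4GaugeCovariance (pathEnd)
open Literature.MathematicalPhysics.QuantumFieldTheory.Balaban1983to89.B3Sect2StatementsPart2 (ScaledKernels)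
open Literature.MathematicalPhysics.QuantumFieldTheory.Balaban1983to89.B1TorusCubeCover (half)
open Literature.MathematicalPhysics.QuantumFieldTheory.Balaban1983to89.B1Ineq225RegularBox (cellBox)
open Literature.MathematicalPhysics.QuantumFieldTheory.Balaban1983to89.B3Ineq210RegularRegion (pieceR)
open Literature.MathematicalPhysics.QuantumFieldTheory.Balaban1983to89.B3Ineq210RegularTorus (mesh_eq_pow_mul)
open Literature.MathematicalPhysics.QuantumFieldTheory.Balaban1983to89.B3Ineq210RegularBox (regBoxKernels scaleB_eq)
open Literature.MathematicalPhysics.QuantumFieldTheory.Balaban1983to89.B3Ineq211RegularTorus (IsAdm one_le_tdist_of_ne')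
open Literature.MathematicalPhysics.QuantumFieldTheory.Balaban1983to89.B3Ineq211RegularRegion (holderTermR)
open Literature.MathematicalPhysics.QuantumFieldTheory.Balaban1983to89.B3Ineq211RegularBoxCarrier (regBoxKernelsH ineq210_iff_BH scaleBH_eq
  holderTermR_le_holderDiffB ineq210_and_211At_regularBoxH_small)
open Literature.MathematicalPhysics.QuantumFieldTheory.King1986.SlicePropagator (SliceKernels holderDeriv Prop37PrintedAt Prop37KingOrder)
open Literature.MathematicalPhysics.QuantumFieldTheory.King1986 (ContinuumLimit.eps)
open Summit.QuantumFields.YangMills.BalabanUVNodes.N15KingModelRung.Curved (VSite bset mem_bset legsK legsK_isAdm legsK_subset_intervalBox)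

variable {P : HiggsLattice.Params} {N : ℕ}

/-! ## §1 The block-norm kernels of the box carrier: readers, the inside step, chain telescoping -/

/-- the end point of a chain is one of its sites. [folklore] -/
theorem pathEnd_mem {X : Type*} : ∀ (y : X) (l : List X), pathEnd y l ∈ y :: l
  | y, [] => by simp [pathEnd]
  | y, w :: l => by
      have h := pathEnd_mem w l
      simp only [pathEnd]
      exact List.mem_cons_of_mem _ h

section Box

variable {hP1 : 1 < P.L} {C : ChargeData N} {Sc : Fin P.d → Finset ℕ} {A : HiggsLattice.VecField P 0} {msq a : ℝ} {k K₀ : ℕ}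

/-- abbreviation-free reader: the box carrier's value kernel. [cite: Balaban1983Higgs3, (2.10) p.426] -/
theorem boxAbsG_eq (j : ℕ) (x x' : {x : HiggsLattice.Site P 0 // x ∈ cellBox k K₀ Sc}) :
    (regBoxKernels hP1 C Sc A msq a k K₀).absG j x x'
      = (P.mesh 0 ^ P.d)⁻¹ * ∑ i' : Ix N, ‖pieceR C (cellBox k K₀ Sc) A msq a k j (cb P N 0 (x'.1, i')) x.1‖ := rfl

/-- the box carrier's derivative kernel at a bond INSIDE the box. [cite: Balaban1983Higgs3, (2.10) p.426] -/
theorem boxAbsDG_eq_of_mem (j : ℕ) (μ : Fin P.d) (x x' : {x : HiggsLattice.Site P 0 // x ∈ cellBox k K₀ Sc}) (h : x.1.shift μ ∈ cellBox k K₀ Sc) :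
    (regBoxKernels hP1 C Sc A msq a k K₀).absDG j μ x x'
      = (P.mesh 0 ^ P.d)⁻¹ * ∑ i' : Ix N, ‖covDeriv C A (pieceR C (cellBox k K₀ Sc) A msq a k j (cb P N 0 (x'.1, i'))) ⟨x.1, μ⟩‖ := by
  classical
  show (if x.1.shift μ ∈ cellBox k K₀ Sc then _ else _) = _
  rw [if_pos h]

/-- the box carrier's value kernel is non-negative. [cite: Balaban1983Higgs3, (2.10) p.426] -/
theorem boxAbsG_nonneg (j : ℕ) (x x' : {x : HiggsLattice.Site P 0 // x ∈ cellBox k K₀ Sc}) :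
    0 ≤ (regBoxKernels hP1 C Sc A msq a k K₀).absG j x x' := by
  rw [boxAbsG_eq]
  exact mul_nonneg (inv_nonneg.2 (pow_nonneg (P.mesh_pos 0).le _)) (Finset.sum_nonneg fun _ _ => norm_nonneg _)

/-- the box carrier's derivative kernel is non-negative (both branches). [cite: Balaban1983Higgs3, (2.10) p.426] -/
theorem boxAbsDG_nonneg (j : ℕ) (μ : Fin P.d) (x x' : {x : HiggsLattice.Site P 0 // x ∈ cellBox k K₀ Sc}) :
    0 ≤ (regBoxKernels hP1 C Sc A msq a k K₀).absDG j μ x x' := by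
  classical
  show 0 ≤ (if x.1.shift μ ∈ cellBox k K₀ Sc then
    (P.mesh 0 ^ P.d)⁻¹ * ∑ i' : Ix N, ‖covDeriv C A (pieceR C (cellBox k K₀ Sc) A msq a k j (cb P N 0 (x'.1, i'))) ⟨x.1, μ⟩‖ else 0)
  split_ifs
  · exact mul_nonneg (inv_nonneg.2 (pow_nonneg (P.mesh_pos 0).le _)) (Finset.sum_nonneg fun _ _ => norm_nonneg _)
  · exact le_rfl

/-- **THE ONE-BOND STEP INSIDE THE BOX**: for a bond `⟨x, x + εe_μ⟩ ⊂ Ω′`,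
`||G_(j)(Ω′,A; x+εe_μ, z)| − |G_(j)(Ω′,A; x, z)|| ≤ ε·|(D_{A,μ}G_(j)(Ω′,A))(x, z)|`. [cite: King1986, (3.62) p.663, p.665] [cite: Balaban1983Higgs3, (2.10) p.426] -/
theorem boxAbsG_step_le (j : ℕ) (x z : {x : HiggsLattice.Site P 0 // x ∈ cellBox k K₀ Sc}) (μ : Fin P.d) (h : x.1.shift μ ∈ cellBox k K₀ Sc) :
    |(regBoxKernels hP1 C Sc A msq a k K₀).absG j ⟨x.1.shift μ, h⟩ z - (regBoxKernels hP1 C Sc A msq a k K₀).absG j x z|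
      ≤ P.mesh 0 * (regBoxKernels hP1 C Sc A msq a k K₀).absDG j μ x z := by
  rw [boxAbsG_eq, boxAbsG_eq, boxAbsDG_eq_of_mem j μ x z h, ← mul_sub, abs_mul,
    abs_of_nonneg (inv_nonneg.2 (pow_nonneg (P.mesh_pos 0).le _)), ← Finset.sum_sub_distrib, mul_left_comm]
  refine mul_le_mul_of_nonneg_left ?_ (inv_nonneg.2 (pow_nonneg (P.mesh_pos 0).le _))
  rw [Finset.mul_sum]
  exact (Finset.abs_sum_le_sum_abs _ _).trans (Finset.sum_le_sum fun i' _ => abs_norm_shift_sub_norm_le C A _ x.1 μ)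

/-- **CHAIN TELESCOPING INSIDE THE BOX**: along a nearest-neighbour chain all of whose sites lie in `Ω′`, with `ε·|(D_{A,μ}G_(j))(w,z)| ≤ M` at every chain
site `w` and direction `μ`, `||G_(j)(end,z)| − |G_(j)(y,z)|| ≤ n·M`. [cite: King1986, (3.62) p.663] [cite: Balaban1982Higgs1, (1.3) p.604] -/
theorem boxAbsG_chain_le (j : ℕ) (z : {x : HiggsLattice.Site P 0 // x ∈ cellBox k K₀ Sc}) {M : ℝ} :
    ∀ (y : HiggsLattice.Site P 0) (l : List (HiggsLattice.Site P 0)), IsTChain y l → ∀ (hy : y ∈ cellBox k K₀ Sc)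
      (hl : ∀ w ∈ l, w ∈ cellBox k K₀ Sc),
      (∀ w (hw : w ∈ y :: l) (hwΩ : w ∈ cellBox k K₀ Sc), ∀ μ : Fin P.d,
          P.mesh 0 * (regBoxKernels hP1 C Sc A msq a k K₀).absDG j μ ⟨w, hwΩ⟩ z ≤ M) →
      ∀ (hend : pathEnd y l ∈ cellBox k K₀ Sc),
      |(regBoxKernels hP1 C Sc A msq a k K₀).absG j ⟨pathEnd y l, hend⟩ z - (regBoxKernels hP1 C Sc A msq a k K₀).absG j ⟨y, hy⟩ z|
        ≤ l.length * M := by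
  intro y l
  induction l generalizing y with
  | nil =>
      intro _ hy _ _ hend
      simp [pathEnd]
  | cons w l ih =>
      intro hch hy hl hM hend
      obtain ⟨⟨μ, hμ⟩, hl'⟩ := hch
      have hwΩ : w ∈ cellBox k K₀ Sc := hl w List.mem_cons_self
      have hM' : ∀ w' (hw' : w' ∈ w :: l) (hw'Ω : w' ∈ cellBox k K₀ Sc), ∀ μ : Fin P.d,
          P.mesh 0 * (regBoxKernels hP1 C Sc A msq a k K₀).absDG j μ ⟨w', hw'Ω⟩ z ≤ M :=
        fun w' hw' hw'Ω μ => hM w' (List.mem_cons_of_mem _ hw') hw'Ω μ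
      have hend' : pathEnd w l ∈ cellBox k K₀ Sc := by simpa [pathEnd] using hend
      have hrest := ih w hl' hwΩ (fun w' hw' => hl w' (List.mem_cons_of_mem _ hw')) hM' hend'
      have hstep : |(regBoxKernels hP1 C Sc A msq a k K₀).absG j ⟨w, hwΩ⟩ z - (regBoxKernels hP1 C Sc A msq a k K₀).absG j ⟨y, hy⟩ z| ≤ M := by
        rcases hμ with hμ | hμ
        · have h' : y.shift μ ∈ cellBox k K₀ Sc := hμ ▸ hwΩ
          have := boxAbsG_step_le (hP1 := hP1) (C := C) (A := A) (msq := msq) (a := a) j ⟨y, hy⟩ z μ h'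
          have hw_eq : (⟨w, hwΩ⟩ : {x : HiggsLattice.Site P 0 // x ∈ cellBox k K₀ Sc}) = ⟨y.shift μ, h'⟩ := Subtype.ext hμ
          rw [hw_eq]
          exact this.trans (hM y List.mem_cons_self hy μ)
        · have h' : w.shift μ ∈ cellBox k K₀ Sc := hμ ▸ hy
          have := boxAbsG_step_le (hP1 := hP1) (C := C) (A := A) (msq := msq) (a := a) j ⟨w, hwΩ⟩ z μ h'
          have hy_eq : (⟨y, hy⟩ : {x : HiggsLattice.Site P 0 // x ∈ cellBox k K₀ Sc}) = ⟨w.shift μ, h'⟩ := Subtype.ext hμ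
          rw [hy_eq, abs_sub_comm]
          exact this.trans (hM w (List.mem_cons_of_mem _ List.mem_cons_self) hwΩ μ)
      have hM0 : 0 ≤ M := le_trans (abs_nonneg _) hstep
      have e : (⟨pathEnd y (w :: l), hend⟩ : {x : HiggsLattice.Site P 0 // x ∈ cellBox k K₀ Sc}) = ⟨pathEnd w l, hend'⟩ := Subtype.ext rfl
      rw [e]
      simp only [List.length_cons, Nat.cast_succ]
      calc |(regBoxKernels hP1 C Sc A msq a k K₀).absG j ⟨pathEnd w l, hend'⟩ z - (regBoxKernels hP1 C Sc A msq a k K₀).absG j ⟨y, hy⟩ z|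
          ≤ |(regBoxKernels hP1 C Sc A msq a k K₀).absG j ⟨pathEnd w l, hend'⟩ z - (regBoxKernels hP1 C Sc A msq a k K₀).absG j ⟨w, hwΩ⟩ z|
              + |(regBoxKernels hP1 C Sc A msq a k K₀).absG j ⟨w, hwΩ⟩ z - (regBoxKernels hP1 C Sc A msq a k K₀).absG j ⟨y, hy⟩ z| :=
            abs_sub_le _ _ _
        _ ≤ l.length * M + M := add_le_add hrest hstep
        _ = (l.length + 1) * M := by ring

end Box

/-! ## §2 The Hölder lines on an interval box, transport-free -/

section IntervalBox

variable {hP1 : 1 < P.L} {C : ChargeData N} {lo hi : Fin P.d → ℕ} {A : HiggsLattice.VecField P 0} {msq a : ℝ} {k K₀ : ℕ}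

/-- exponential weights with a shifted argument. [folklore] -/
private theorem exp_neg_mul_sub' (ρ t u : ℝ) : Real.exp (-(ρ * (t - u))) = Real.exp (-(ρ * t)) * Real.exp (ρ * u) := by
  rw [← Real.exp_add]; congr 1; ring

/-- ★ **(3.65)₁ FOR NEAR PAIRS ON AN INTERVAL BOX** (`ε|x − y| ≤ L^jε`, `x, y ∈ Ω′`, sides ≤ half the torus, `K₀ ≥ 1`): under (2.10) on the box at `(δ, Cst)`,
`||G_(j)(x,z)| − |G_(j)(y,z)|| ≤ d·Cst·e^{δd}·(ε|x−y|)^α(L^jε)^{2−d−α}e^{−δ(L^jε)^{−1}ε·min(|x−z|,|y−z|)}` — chained along the coordinate staircase `legsK y x ⊂ Ω′`.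
[cite: King1986, Prop 3.7 (3.65) p.663, p.665] [cite: Balaban1983Higgs3, (2.10) p.426] -/
theorem absG_holder_near_box (hK₀ : 1 ≤ K₀) (hside : ∀ μ, 2 * ((hi μ - lo μ) * half P k K₀) ≤ P.sitesPerDir 0 μ)
    {δ Cst : ℝ} (hδ : 0 ≤ δ) (hCst : 0 ≤ Cst)
    (h210 : (regBoxKernels hP1 C (fun μ => Finset.Ico (lo μ) (hi μ)) A msq a k K₀).Ineq210 δ Cst)
    {α : ℝ} (hα1 : α ≤ 1) (j : ℕ) (x y z : {x : HiggsLattice.Site P 0 // x ∈ cellBox k K₀ (fun μ => Finset.Ico (lo μ) (hi μ))})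
    (hxy : x.1 ≠ y.1) (hnear : P.mesh 0 * (HiggsLattice.Site.tdist x.1 y.1 : ℝ) ≤ P.mesh j) :
    |(regBoxKernels hP1 C (fun μ => Finset.Ico (lo μ) (hi μ)) A msq a k K₀).absG j x z
        - (regBoxKernels hP1 C (fun μ => Finset.Ico (lo μ) (hi μ)) A msq a k K₀).absG j y z|
      ≤ (P.d : ℝ) * Cst * Real.exp (δ * P.d) * (P.mesh 0 * (HiggsLattice.Site.tdist x.1 y.1 : ℝ)) ^ α
          * P.mesh j ^ ((2 : ℝ) - (P.d : ℝ) - α)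
          * Real.exp (-(δ * (P.mesh j)⁻¹ * (P.mesh 0 * min (HiggsLattice.Site.tdist x.1 z.1 : ℝ) (HiggsLattice.Site.tdist y.1 z.1 : ℝ)))) := by
  set K := regBoxKernels hP1 C (fun μ => Finset.Ico (lo μ) (hi μ)) A msq a k K₀ with hK
  have hε : 0 < P.mesh 0 := P.mesh_pos 0
  have hs : 0 < P.mesh j := P.mesh_pos j
  obtain ⟨hch, hend, hlen⟩ := legsK_isAdm y.1 x.1
  have hinside : ∀ w ∈ legsK y.1 x.1, w ∈ cellBox k K₀ (fun μ => Finset.Ico (lo μ) (hi μ)) := legsK_subset_intervalBox hK₀ hside x.1 y.1 x.2 y.2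
  set Γ := legsK y.1 x.1 with hΓ
  set r : ℝ := P.mesh 0 * (HiggsLattice.Site.tdist x.1 y.1 : ℝ) with hr
  have hr0 : 0 < r := by
    have h1 : (1 : ℝ) ≤ HiggsLattice.Site.tdist x.1 y.1 := by exact_mod_cast one_le_tdist_of_ne' (Ne.symm hxy)
    rw [hr]; positivity
  have htxy : (HiggsLattice.Site.tdist y.1 x.1 : ℝ) = HiggsLattice.Site.tdist x.1 y.1 := by rw [tdist_comm]
  set Emin : ℝ := Real.exp (-(δ * (P.mesh j)⁻¹ * (P.mesh 0 * min (HiggsLattice.Site.tdist x.1 z.1 : ℝ) (HiggsLattice.Site.tdist y.1 z.1 : ℝ))))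
    with hEmin
  set M : ℝ := P.mesh 0 * (Cst * P.mesh j ^ ((1 : ℝ) - (P.d : ℝ)) * (Emin * Real.exp (δ * P.d))) with hM
  have hchain : ∀ w (hw : w ∈ y.1 :: Γ) (hwΩ : w ∈ cellBox k K₀ (fun μ => Finset.Ico (lo μ) (hi μ))), ∀ μ : Fin P.d, P.mesh 0 * K.absDG j μ ⟨w, hwΩ⟩ z ≤ M := by
    intro w hw hwΩ μ
    have hb := ((h210 j ⟨w, hwΩ⟩ z).2 μ)
    have e3 : K.dist ⟨w, hwΩ⟩ z = P.mesh 0 * (HiggsLattice.Site.tdist w z.1 : ℝ) := rfl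
    have e4 : (K.d : ℝ) = P.d := rfl
    rw [scaleB_eq, e3, e4] at hb
    have hyw : (HiggsLattice.Site.tdist y.1 w : ℝ) ≤ Γ.length := tdist_mem_chain_le hch w hw
    have hlen' : (Γ.length : ℝ) ≤ (P.d : ℝ) * HiggsLattice.Site.tdist x.1 y.1 := by rw [← htxy]; exact hlen
    have htri : (HiggsLattice.Site.tdist y.1 z.1 : ℝ) ≤ HiggsLattice.Site.tdist y.1 w + HiggsLattice.Site.tdist w z.1 := tdist_triangle_real _ _ _
    have hmin : min (HiggsLattice.Site.tdist x.1 z.1 : ℝ) (HiggsLattice.Site.tdist y.1 z.1 : ℝ) ≤ HiggsLattice.Site.tdist y.1 z.1 := min_le_right _ _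
    have hwz : min (HiggsLattice.Site.tdist x.1 z.1 : ℝ) (HiggsLattice.Site.tdist y.1 z.1 : ℝ) - (P.d : ℝ) * HiggsLattice.Site.tdist x.1 y.1
        ≤ (HiggsLattice.Site.tdist w z.1 : ℝ) := by linarith
    have hexp : Real.exp (-(δ * (P.mesh j)⁻¹ * (P.mesh 0 * (HiggsLattice.Site.tdist w z.1 : ℝ)))) ≤ Emin * Real.exp (δ * P.d) := by
      have hρ : 0 ≤ δ * (P.mesh j)⁻¹ * P.mesh 0 := by positivity
      calc Real.exp (-(δ * (P.mesh j)⁻¹ * (P.mesh 0 * (HiggsLattice.Site.tdist w z.1 : ℝ))))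
          ≤ Real.exp (-(δ * (P.mesh j)⁻¹ * (P.mesh 0 *
              (min (HiggsLattice.Site.tdist x.1 z.1 : ℝ) (HiggsLattice.Site.tdist y.1 z.1 : ℝ) - (P.d : ℝ) * HiggsLattice.Site.tdist x.1 y.1)))) := by
            rw [Real.exp_le_exp, neg_le_neg_iff, ← mul_assoc, ← mul_assoc]
            exact mul_le_mul_of_nonneg_left hwz hρ
        _ = Emin * Real.exp (δ * (P.mesh j)⁻¹ * ((P.d : ℝ) * r)) := by
            rw [hEmin, hr, mul_sub, ← exp_neg_mul_sub']; congr 1; ring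
        _ ≤ Emin * Real.exp (δ * P.d) := by
            refine mul_le_mul_of_nonneg_left (Real.exp_le_exp.2 ?_) (Real.exp_nonneg _)
            have h1 : (P.mesh j)⁻¹ * r ≤ 1 := by rw [inv_mul_le_iff₀ hs]; simpa [hr] using hnear
            have hd0 : (0 : ℝ) ≤ P.d := Nat.cast_nonneg _
            calc δ * (P.mesh j)⁻¹ * ((P.d : ℝ) * r) = δ * P.d * ((P.mesh j)⁻¹ * r) := by ring
              _ ≤ δ * P.d * 1 := mul_le_mul_of_nonneg_left h1 (mul_nonneg hδ hd0)
              _ = δ * P.d := mul_one _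
    calc P.mesh 0 * K.absDG j μ ⟨w, hwΩ⟩ z
        ≤ P.mesh 0 * (Cst * P.mesh j ^ ((1 : ℝ) - (P.d : ℝ)) * Real.exp (-(δ * (P.mesh j)⁻¹ * (P.mesh 0 * (HiggsLattice.Site.tdist w z.1 : ℝ))))) :=
          mul_le_mul_of_nonneg_left hb hε.le
      _ ≤ M := by
          rw [hM]
          exact mul_le_mul_of_nonneg_left (mul_le_mul_of_nonneg_left hexp (by positivity)) hε.le
  have hendΩ : pathEnd y.1 Γ ∈ cellBox k K₀ (fun μ => Finset.Ico (lo μ) (hi μ)) := by rw [hend]; exact x.2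
  have hmain := boxAbsG_chain_le (hP1 := hP1) (C := C) (A := A) (msq := msq) (a := a) j z y.1 Γ hch y.2 hinside hchain hendΩ
  have ex : (⟨pathEnd y.1 Γ, hendΩ⟩ : {x : HiggsLattice.Site P 0 // x ∈ cellBox k K₀ (fun μ => Finset.Ico (lo μ) (hi μ))}) = x := Subtype.ext hend
  have ey : (⟨y.1, y.2⟩ : {x : HiggsLattice.Site P 0 // x ∈ cellBox k K₀ (fun μ => Finset.Ico (lo μ) (hi μ))}) = y := Subtype.ext rfl
  rw [ex, ey] at hmain
  have hM0 : 0 ≤ M := by rw [hM]; positivity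
  have hlen' : (Γ.length : ℝ) ≤ (P.d : ℝ) * HiggsLattice.Site.tdist x.1 y.1 := by rw [← htxy]; exact hlen
  refine hmain.trans ((mul_le_mul_of_nonneg_right hlen' hM0).trans ?_)
  have hkey : r * P.mesh j ^ ((1 : ℝ) - (P.d : ℝ)) ≤ r ^ α * P.mesh j ^ ((2 : ℝ) - (P.d : ℝ) - α) := by
    have hrle : r ≤ P.mesh j := by simpa [hr] using hnear
    have h1 : r = r ^ α * r ^ (1 - α) := by
      rw [← Real.rpow_add hr0]; norm_num
    have h2 : r ^ (1 - α) ≤ P.mesh j ^ (1 - α) := Real.rpow_le_rpow hr0.le hrle (by linarith)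
    have h3 : P.mesh j ^ (1 - α) * P.mesh j ^ ((1 : ℝ) - (P.d : ℝ)) = P.mesh j ^ ((2 : ℝ) - (P.d : ℝ) - α) := by
      rw [← Real.rpow_add hs]; congr 1; ring
    calc r * P.mesh j ^ ((1 : ℝ) - (P.d : ℝ)) = r ^ α * (r ^ (1 - α) * P.mesh j ^ ((1 : ℝ) - (P.d : ℝ))) := by
          rw [← mul_assoc, ← h1]
      _ ≤ r ^ α * (P.mesh j ^ (1 - α) * P.mesh j ^ ((1 : ℝ) - (P.d : ℝ))) :=
          mul_le_mul_of_nonneg_left (mul_le_mul_of_nonneg_right h2 (Real.rpow_nonneg hs.le _)) (Real.rpow_nonneg hr0.le _)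
      _ = r ^ α * P.mesh j ^ ((2 : ℝ) - (P.d : ℝ) - α) := by rw [h3]
  calc (P.d : ℝ) * (HiggsLattice.Site.tdist x.1 y.1 : ℝ) * M
      = (P.d : ℝ) * Cst * Real.exp (δ * P.d) * (r * P.mesh j ^ ((1 : ℝ) - (P.d : ℝ))) * Emin := by rw [hM, hr]; ring
    _ ≤ (P.d : ℝ) * Cst * Real.exp (δ * P.d) * (r ^ α * P.mesh j ^ ((2 : ℝ) - (P.d : ℝ) - α)) * Emin :=
        mul_le_mul_of_nonneg_right (mul_le_mul_of_nonneg_left hkey (by positivity)) (Real.exp_nonneg _)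
    _ = (P.d : ℝ) * Cst * Real.exp (δ * P.d) * r ^ α * P.mesh j ^ ((2 : ℝ) - (P.d : ℝ) - α) * Emin := by ring

/-- ★ **(3.65)₁ FOR FAR PAIRS ON THE BOX** (`L^jε ≤ ε|x − y|`): by sizes. [cite: King1986, Prop 3.7 (3.65) p.663] [cite: Balaban1983Higgs3, (2.10) p.426] -/
theorem absG_holder_far_box {Sc : Fin P.d → Finset ℕ} {δ Cst : ℝ} (hδ : 0 ≤ δ) (hCst : 0 ≤ Cst)
    (h210 : (regBoxKernels hP1 C Sc A msq a k K₀).Ineq210 δ Cst) {α : ℝ} (hα0 : 0 ≤ α) (j : ℕ)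
    (x y z : {x : HiggsLattice.Site P 0 // x ∈ cellBox k K₀ Sc}) (hfar : P.mesh j ≤ P.mesh 0 * (HiggsLattice.Site.tdist x.1 y.1 : ℝ)) :
    |(regBoxKernels hP1 C Sc A msq a k K₀).absG j x z - (regBoxKernels hP1 C Sc A msq a k K₀).absG j y z|
      ≤ 2 * Cst * (P.mesh 0 * (HiggsLattice.Site.tdist x.1 y.1 : ℝ)) ^ α * P.mesh j ^ ((2 : ℝ) - (P.d : ℝ) - α)
          * Real.exp (-(δ * (P.mesh j)⁻¹ * (P.mesh 0 * min (HiggsLattice.Site.tdist x.1 z.1 : ℝ) (HiggsLattice.Site.tdist y.1 z.1 : ℝ)))) := by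
  set K := regBoxKernels hP1 C Sc A msq a k K₀ with hK
  have hε : 0 < P.mesh 0 := P.mesh_pos 0
  have hs : 0 < P.mesh j := P.mesh_pos j
  set r : ℝ := P.mesh 0 * (HiggsLattice.Site.tdist x.1 y.1 : ℝ) with hr
  set m : ℝ := min (HiggsLattice.Site.tdist x.1 z.1 : ℝ) (HiggsLattice.Site.tdist y.1 z.1 : ℝ) with hm
  have hx := (h210 j x z).1
  have hy := (h210 j y z).1
  have e3 : K.dist x z = P.mesh 0 * (HiggsLattice.Site.tdist x.1 z.1 : ℝ) := rfl
  have e3' : K.dist y z = P.mesh 0 * (HiggsLattice.Site.tdist y.1 z.1 : ℝ) := rfl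
  have e4 : (K.d : ℝ) = P.d := rfl
  rw [scaleB_eq, e3, e4] at hx
  rw [scaleB_eq, e3', e4] at hy
  have hρ : 0 ≤ δ * (P.mesh j)⁻¹ * P.mesh 0 := by positivity
  have hex : Real.exp (-(δ * (P.mesh j)⁻¹ * (P.mesh 0 * (HiggsLattice.Site.tdist x.1 z.1 : ℝ)))) ≤ Real.exp (-(δ * (P.mesh j)⁻¹ * (P.mesh 0 * m))) := by
    rw [Real.exp_le_exp, neg_le_neg_iff, ← mul_assoc, ← mul_assoc]
    exact mul_le_mul_of_nonneg_left (min_le_left _ _) hρ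
  have hey : Real.exp (-(δ * (P.mesh j)⁻¹ * (P.mesh 0 * (HiggsLattice.Site.tdist y.1 z.1 : ℝ)))) ≤ Real.exp (-(δ * (P.mesh j)⁻¹ * (P.mesh 0 * m))) := by
    rw [Real.exp_le_exp, neg_le_neg_iff, ← mul_assoc, ← mul_assoc]
    exact mul_le_mul_of_nonneg_left (min_le_right _ _) hρ
  have hsize : P.mesh j ^ ((2 : ℝ) - (P.d : ℝ)) ≤ r ^ α * P.mesh j ^ ((2 : ℝ) - (P.d : ℝ) - α) := by
    have h1 : P.mesh j ^ ((2 : ℝ) - (P.d : ℝ)) = P.mesh j ^ α * P.mesh j ^ ((2 : ℝ) - (P.d : ℝ) - α) := by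
      rw [← Real.rpow_add hs]; congr 1; ring
    rw [h1]
    exact mul_le_mul_of_nonneg_right (Real.rpow_le_rpow hs.le hfar hα0) (Real.rpow_nonneg hs.le _)
  have hG0x := boxAbsG_nonneg (hP1 := hP1) (C := C) (Sc := Sc) (A := A) (msq := msq) (a := a) (k := k) (K₀ := K₀) j x z
  have hG0y := boxAbsG_nonneg (hP1 := hP1) (C := C) (Sc := Sc) (A := A) (msq := msq) (a := a) (k := k) (K₀ := K₀) j y z
  calc |K.absG j x z - K.absG j y z|
      ≤ K.absG j x z + K.absG j y z := by rw [abs_le]; constructor <;> linarith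
    _ ≤ Cst * P.mesh j ^ ((2 : ℝ) - (P.d : ℝ)) * Real.exp (-(δ * (P.mesh j)⁻¹ * (P.mesh 0 * m)))
        + Cst * P.mesh j ^ ((2 : ℝ) - (P.d : ℝ)) * Real.exp (-(δ * (P.mesh j)⁻¹ * (P.mesh 0 * m))) :=
        add_le_add (hx.trans (mul_le_mul_of_nonneg_left hex (by positivity))) (hy.trans (mul_le_mul_of_nonneg_left hey (by positivity)))
    _ = 2 * Cst * P.mesh j ^ ((2 : ℝ) - (P.d : ℝ)) * Real.exp (-(δ * (P.mesh j)⁻¹ * (P.mesh 0 * m))) := by ring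
    _ ≤ 2 * Cst * (r ^ α * P.mesh j ^ ((2 : ℝ) - (P.d : ℝ) - α)) * Real.exp (-(δ * (P.mesh j)⁻¹ * (P.mesh 0 * m))) :=
        mul_le_mul_of_nonneg_right (mul_le_mul_of_nonneg_left hsize (by positivity)) (Real.exp_nonneg _)
    _ = 2 * Cst * r ^ α * P.mesh j ^ ((2 : ℝ) - (P.d : ℝ) - α) * Real.exp (-(δ * (P.mesh j)⁻¹ * (P.mesh 0 * m))) := by ring

/-- ★★ **(3.65)₁ TRANSPORT-FREE ON AN INTERVAL BOX, ALL PAIRS `x ≠ y` OF THE BOX** (sides ≤ half the torus, `K₀ ≥ 1`): under (2.10) on the box,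
`||G_(j)(Ω′,A;x,z)| − |G_(j)(Ω′,A;y,z)|| ≤ (d·e^{δd} + 2)·Cst·(ε|x−y|)^α(L^jε)^{2−d−α}e^{−δ(L^jε)^{−1}dist({x,y},z)}`. [cite: King1986, Prop 3.7 (3.65) p.663, p.665]
[cite: Balaban1983Higgs3, (2.10) p.426] [cite: Balaban1982Higgs1, p.611 l.1–2] -/
theorem absG_holder_le_box (hK₀ : 1 ≤ K₀) (hside : ∀ μ, 2 * ((hi μ - lo μ) * half P k K₀) ≤ P.sitesPerDir 0 μ)
    {δ Cst : ℝ} (hδ : 0 ≤ δ) (hCst : 0 ≤ Cst)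
    (h210 : (regBoxKernels hP1 C (fun μ => Finset.Ico (lo μ) (hi μ)) A msq a k K₀).Ineq210 δ Cst)
    {α : ℝ} (hα0 : 0 ≤ α) (hα1 : α ≤ 1) (j : ℕ) (x y z : {x : HiggsLattice.Site P 0 // x ∈ cellBox k K₀ (fun μ => Finset.Ico (lo μ) (hi μ))})
    (hxy : x.1 ≠ y.1) :
    |(regBoxKernels hP1 C (fun μ => Finset.Ico (lo μ) (hi μ)) A msq a k K₀).absG j x z
        - (regBoxKernels hP1 C (fun μ => Finset.Ico (lo μ) (hi μ)) A msq a k K₀).absG j y z|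
      ≤ ((P.d : ℝ) * Real.exp (δ * P.d) + 2) * Cst * (P.mesh 0 * (HiggsLattice.Site.tdist x.1 y.1 : ℝ)) ^ α
          * P.mesh j ^ ((2 : ℝ) - (P.d : ℝ) - α)
          * Real.exp (-(δ * (P.mesh j)⁻¹ * (P.mesh 0 * min (HiggsLattice.Site.tdist x.1 z.1 : ℝ) (HiggsLattice.Site.tdist y.1 z.1 : ℝ)))) := by
  set W : ℝ := (P.mesh 0 * (HiggsLattice.Site.tdist x.1 y.1 : ℝ)) ^ α * P.mesh j ^ ((2 : ℝ) - (P.d : ℝ) - α)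
      * Real.exp (-(δ * (P.mesh j)⁻¹ * (P.mesh 0 * min (HiggsLattice.Site.tdist x.1 z.1 : ℝ) (HiggsLattice.Site.tdist y.1 z.1 : ℝ)))) with hW
  have hW0 : 0 ≤ W := by
    rw [hW]
    exact mul_nonneg (mul_nonneg (Real.rpow_nonneg (mul_nonneg (P.mesh_pos 0).le (Nat.cast_nonneg _)) _)
      (Real.rpow_nonneg (P.mesh_pos j).le _)) (Real.exp_nonneg _)
  have hgoal : ((P.d : ℝ) * Real.exp (δ * P.d) + 2) * Cst * (P.mesh 0 * (HiggsLattice.Site.tdist x.1 y.1 : ℝ)) ^ α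
        * P.mesh j ^ ((2 : ℝ) - (P.d : ℝ) - α)
        * Real.exp (-(δ * (P.mesh j)⁻¹ * (P.mesh 0 * min (HiggsLattice.Site.tdist x.1 z.1 : ℝ) (HiggsLattice.Site.tdist y.1 z.1 : ℝ))))
      = (P.d : ℝ) * Cst * Real.exp (δ * P.d) * W + 2 * Cst * W := by rw [hW]; ring
  rw [hgoal]
  rcases le_total (P.mesh 0 * (HiggsLattice.Site.tdist x.1 y.1 : ℝ)) (P.mesh j) with hnear | hfar
  · have h := absG_holder_near_box hK₀ hside hδ hCst h210 hα1 j x y z hxy hnear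
    have h' : |(regBoxKernels hP1 C (fun μ => Finset.Ico (lo μ) (hi μ)) A msq a k K₀).absG j x z
          - (regBoxKernels hP1 C (fun μ => Finset.Ico (lo μ) (hi μ)) A msq a k K₀).absG j y z|
        ≤ (P.d : ℝ) * Cst * Real.exp (δ * P.d) * W := by rw [hW]; simpa [mul_assoc] using h
    exact h'.trans (le_add_of_nonneg_right (by positivity))
  · have h := absG_holder_far_box hδ hCst h210 hα0 j x y z hfar
    have h' : |(regBoxKernels hP1 C (fun μ => Finset.Ico (lo μ) (hi μ)) A msq a k K₀).absG j x z
          - (regBoxKernels hP1 C (fun μ => Finset.Ico (lo μ) (hi μ)) A msq a k K₀).absG j y z| ≤ 2 * Cst * W := by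
      rw [hW]; simpa [mul_assoc] using h
    exact h'.trans (le_add_of_nonneg_left (by positivity))

/-- ★★ **(3.65)₂ TRANSPORT-FREE ON AN INTERVAL BOX FROM (2.11) VERBATIM**, for bond-closed sites `x ≠ y` (`x + εe_μ, y + εe_μ ∈ Ω′`): under `Ineq211At α δ Cst` for
p26's Hölder box carrier, `||(D_{A,μ}G_(j))(x,z)| − |(D_{A,μ}G_(j))(y,z)|| ≤ Cst·(ε|x−y|)^α(L^jε)^{1−d−α}e^{−δ(L^jε)^{−1}dist({x,y},z)}` (the transported term along
`legsK y x ⊂ Ω′` is dominated by the carrier's supremum: `holderTermR_le_holderDiffB`; the transport is an isometry). [cite: King1986, Prop 3.7 (3.62), (3.65) p.663, p.665]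
[cite: Balaban1983Higgs3, (2.11) p.426] -/
theorem absDG_holder_le_box (hK₀ : 1 ≤ K₀) (hside : ∀ μ, 2 * ((hi μ - lo μ) * half P k K₀) ≤ P.sitesPerDir 0 μ) {α δ Cst : ℝ}
    (h211 : (regBoxKernelsH hP1 C (fun μ => Finset.Ico (lo μ) (hi μ)) A msq a k K₀).Ineq211At α δ Cst) (j : ℕ) (μ : Fin P.d)
    (x y z : {x : HiggsLattice.Site P 0 // x ∈ cellBox k K₀ (fun μ => Finset.Ico (lo μ) (hi μ))}) (hxy : x.1 ≠ y.1)
    (hxμ : x.1.shift μ ∈ cellBox k K₀ (fun μ => Finset.Ico (lo μ) (hi μ))) (hyμ : y.1.shift μ ∈ cellBox k K₀ (fun μ => Finset.Ico (lo μ) (hi μ))) :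
    |(regBoxKernels hP1 C (fun μ => Finset.Ico (lo μ) (hi μ)) A msq a k K₀).absDG j μ x z
        - (regBoxKernels hP1 C (fun μ => Finset.Ico (lo μ) (hi μ)) A msq a k K₀).absDG j μ y z|
      ≤ Cst * (P.mesh 0 * (HiggsLattice.Site.tdist x.1 y.1 : ℝ)) ^ α * P.mesh j ^ ((1 : ℝ) - (P.d : ℝ) - α)
          * Real.exp (-(δ * (P.mesh j)⁻¹ * (P.mesh 0 * min (HiggsLattice.Site.tdist x.1 z.1 : ℝ) (HiggsLattice.Site.tdist y.1 z.1 : ℝ)))) := by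
  have hε : 0 < P.mesh 0 := P.mesh_pos 0
  have hΓ := legsK_isAdm y.1 x.1
  have hΓΩ : ∀ w ∈ legsK y.1 x.1, w ∈ cellBox k K₀ (fun μ => Finset.Ico (lo μ) (hi μ)) := legsK_subset_intervalBox hK₀ hside x.1 y.1 x.2 y.2
  -- the plain difference is dominated by the transported term along `legsK y x`
  have h1 : |(regBoxKernels hP1 C (fun μ => Finset.Ico (lo μ) (hi μ)) A msq a k K₀).absDG j μ x z
        - (regBoxKernels hP1 C (fun μ => Finset.Ico (lo μ) (hi μ)) A msq a k K₀).absDG j μ y z|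
      ≤ holderTermR C (cellBox k K₀ (fun μ => Finset.Ico (lo μ) (hi μ))) A msq a k j μ y.1 x.1 z.1 (legsK y.1 x.1) := by
    rw [boxAbsDG_eq_of_mem j μ x z hxμ, boxAbsDG_eq_of_mem j μ y z hyμ, holderTermR, ← mul_sub, abs_mul,
      abs_of_nonneg (inv_nonneg.2 (pow_nonneg (P.mesh_pos 0).le _)), ← Finset.sum_sub_distrib]
    refine mul_le_mul_of_nonneg_left ?_ (inv_nonneg.2 (pow_nonneg (P.mesh_pos 0).le _))
    exact (Finset.abs_sum_le_sum_abs _ _).trans (Finset.sum_le_sum fun i' _ => abs_norm_sub_norm_le_hol C A y.1 _ _ _)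
  have h2 := holderTermR_le_holderDiffB (hL1 := hP1) (C := C) (A := A) (msq := msq) (a := a) j μ y x z hyμ hxμ hΓ hΓΩ
  have h3 := h211 j μ y x z (fun h => hxy (congrArg Subtype.val h).symm)
  have hdist : (regBoxKernelsH hP1 C (fun μ => Finset.Ico (lo μ) (hi μ)) A msq a k K₀).dist y x
      = P.mesh 0 * (HiggsLattice.Site.tdist x.1 y.1 : ℝ) := by
    show P.mesh 0 * (HiggsLattice.Site.tdist y.1 x.1 : ℝ) = _; rw [tdist_comm]
  have hdist2 : (regBoxKernelsH hP1 C (fun μ => Finset.Ico (lo μ) (hi μ)) A msq a k K₀).dist2 y x z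
      = P.mesh 0 * min (HiggsLattice.Site.tdist x.1 z.1 : ℝ) (HiggsLattice.Site.tdist y.1 z.1 : ℝ) := by
    show P.mesh 0 * min (HiggsLattice.Site.tdist y.1 z.1 : ℝ) (HiggsLattice.Site.tdist x.1 z.1 : ℝ) = _; rw [min_comm]
  have hd : ((regBoxKernelsH hP1 C (fun μ => Finset.Ico (lo μ) (hi μ)) A msq a k K₀).d : ℝ) = P.d := rfl
  rw [scaleBH_eq, hdist, hdist2, hd] at h3
  have hr0 : 0 < P.mesh 0 * (HiggsLattice.Site.tdist x.1 y.1 : ℝ) := by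
    have : (1 : ℝ) ≤ HiggsLattice.Site.tdist x.1 y.1 := by exact_mod_cast one_le_tdist_of_ne' (Ne.symm hxy)
    positivity
  have hrα : 0 < (P.mesh 0 * (HiggsLattice.Site.tdist x.1 y.1 : ℝ)) ^ α := Real.rpow_pos_of_pos hr0 _
  rw [div_le_iff₀ hrα] at h3
  calc |(regBoxKernels hP1 C (fun μ => Finset.Ico (lo μ) (hi μ)) A msq a k K₀).absDG j μ x z
          - (regBoxKernels hP1 C (fun μ => Finset.Ico (lo μ) (hi μ)) A msq a k K₀).absDG j μ y z|
      ≤ (regBoxKernelsH hP1 C (fun μ => Finset.Ico (lo μ) (hi μ)) A msq a k K₀).holderDiff j μ y x z := h1.trans h2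
    _ ≤ Cst * P.mesh j ^ ((1 : ℝ) - (P.d : ℝ) - α)
          * Real.exp (-(δ * (P.mesh j)⁻¹ * (P.mesh 0 * min (HiggsLattice.Site.tdist x.1 z.1 : ℝ) (HiggsLattice.Site.tdist y.1 z.1 : ℝ))))
          * (P.mesh 0 * (HiggsLattice.Site.tdist x.1 y.1 : ℝ)) ^ α := h3
    _ = _ := by ring

end IntervalBox

end Summit.QuantumFields.YangMills.BalabanUVNodes.N15KingModelRung.RegularField

end
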